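import Mathlib.Analysis.SpecialFunctions.Pow.Real
import HarnessLib

/-!
# Wei 2016, §3, (3.7) and the two cases `r(t) = εK/a(t)`, `r(t) = r₀`: real-variable form

Analysis/FluidPDE proof file (theorems only; no definitions, no named facts) on the way to
`Literature.Analysis.FluidPDE.Wei2016_logModulus_regularity`
(`LeiZhang2017AxisymmetricCriteria.lean`), after D. Wei, J. Math. Anal. Appl. 435 (2016) =
arXiv:1508.03318, §3, (3.7) and p. 8: "`d/dt A ≤ (CM₂/r(t)²) min{A(t), ‖∇u(t)‖²/r(t)²}`. Fix
`t`, if `r(t) = εK(ε)/a(t) ≤ r₀`, by Lemma 2.2, `a(t)² ≤ A(t)^{1/2}‖∇u(t)‖`,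
`1/r(t)² ≤ A^{1/2}‖∇u‖/(εK)²`, and (3.7) implies `d/dt A ≤ CM₂A^{4/3}‖∇u‖²/(εK)^{8/3}`; otherwise
`r(t) = r₀` and `d/dt A ≤ CM₂‖∇u‖²/r₀⁴`. Combining the above two cases
`d/dt A ≤ CM₂‖∇u‖² max{A^{4/3}/(εK)^{8/3}, r₀^{-4}}`."

This is real-variable bookkeeping once the two far-field bounds `X ≤ c_A A` and
`X ≤ c_e e/r²` of the bracket `X = ε^{2/3}(F_W + F_Ω) + F_J` (`e = ‖∇u‖²`) are known:

* `Wei2016.min_le_rpow_two_thirds_mul_rpow_third` — `min x y ≤ x^{2/3} y^{1/3}` (`x, y ≥ 0`);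
* `Wei2016.far_field_ode_bound` — if `0 ≤ X ≤ c_A A`, `X ≤ c_e e/r²`, `r = min (L/a) r₀` with
  `a, L, r₀ > 0` and `a² ≤ (A e)^{1/2}`-type bound `a ^ 2 ≤ A^{1/2} (c e)^{1/2}`… precisely
  `a² ≤ √A · √(c·e)`, then
  `X/r² ≤ (c_A^{2/3} c_e^{1/3} c^{2/3} + c_e) · e · max{A^{4/3}/L^{8/3}, r₀^{-4}}`
  (`L = εK(ε)`).

## References

* D. Wei, arXiv:1508.03318, §3, (3.7) and the case distinction on p. 8. [Wei2016]
-/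

noncomputable section

open Set

namespace Literature.Analysis.FluidPDE

namespace Wei2016

/-- `min x y ≤ x^{2/3} y^{1/3}` for `x, y ≥ 0` (the smaller factor is bounded by the weighted
geometric mean). [folklore] -/
theorem min_le_rpow_two_thirds_mul_rpow_third {x y : ℝ} (hx : 0 ≤ x) (hy : 0 ≤ y) :
    min x y ≤ x ^ (2 / 3 : ℝ) * y ^ (1 / 3 : ℝ) := by
  rcases le_total x y with h | h
  · rw [min_eq_left h]
    calc x = x ^ (2 / 3 : ℝ) * x ^ (1 / 3 : ℝ) := by
          rw [← Real.rpow_add' hx (by norm_num)]; norm_num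
      _ ≤ x ^ (2 / 3 : ℝ) * y ^ (1 / 3 : ℝ) := by
          gcongr
  · rw [min_eq_right h]
    calc y = y ^ (2 / 3 : ℝ) * y ^ (1 / 3 : ℝ) := by
          rw [← Real.rpow_add' hy (by norm_num)]; norm_num
      _ ≤ x ^ (2 / 3 : ℝ) * y ^ (1 / 3 : ℝ) := by
          gcongr

/-- **The two cases of the proof of Thm. 1.1, combined** (real-variable form). Let `A, e ≥ 0`,
`X ≤ c_A A` and `X ≤ c_e e / r²`, where `r = min (L/a) r₀` with `a, L, r₀ > 0` and
`a² ≤ √A √(c e)` (Lemma 2.2 with `‖u_θ/r‖₂ ≤ √c ‖∇u‖₂`; `c_A, c_e, c ≥ 0`). Then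
`X / r² ≤ (c_A^{2/3} c_e^{1/3} c^{2/3} + c_e) · e · max{A^{4/3}/L^{8/3}, r₀^{-4}}`.
Case `r = L/a`: `1/r² = a²/L² ≤ √A√(ce)/L²` and
`X/r² ≤ (1/r²) (c_A A)^{2/3} (c_e e/r²)^{1/3} = (1/r²)^{4/3} c_A^{2/3}c_e^{1/3} A^{2/3} e^{1/3}
 ≤ c_A^{2/3}c_e^{1/3}c^{2/3} A^{4/3} e/L^{8/3}`; case `r = r₀`: `X/r² ≤ c_e e/r₀⁴`.
[cite: Wei2016, §3 (3.7) and p. 8 (the two cases)] -/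
theorem far_field_ode_bound {A e X cA ce c a L r₀ : ℝ} (hA : 0 ≤ A) (he : 0 ≤ e)
    (hcA : 0 ≤ cA) (hce : 0 ≤ ce) (hc : 0 ≤ c) (ha : 0 < a) (hL : 0 < L) (hr₀ : 0 < r₀)
    (hXA : X ≤ cA * A) (hXe : X ≤ ce * e / (min (L / a) r₀) ^ 2)
    (ha2 : a ^ 2 ≤ Real.sqrt A * Real.sqrt (c * e)) :
    X / (min (L / a) r₀) ^ 2 ≤
      (cA ^ (2 / 3 : ℝ) * ce ^ (1 / 3 : ℝ) * c ^ (2 / 3 : ℝ) + ce) * e *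
        max (A ^ (4 / 3 : ℝ) / L ^ (8 / 3 : ℝ)) (r₀ ^ 4)⁻¹ := by
  set r : ℝ := min (L / a) r₀ with hr
  have hrpos : 0 < r := lt_min (div_pos hL ha) hr₀
  have hr2 : 0 < r ^ 2 := pow_pos hrpos 2
  have hmax0 : 0 ≤ max (A ^ (4 / 3 : ℝ) / L ^ (8 / 3 : ℝ)) (r₀ ^ 4)⁻¹ :=
    le_max_of_le_right (inv_nonneg.2 (pow_nonneg hr₀.le 4))
  have hK0 : 0 ≤ cA ^ (2 / 3 : ℝ) * ce ^ (1 / 3 : ℝ) * c ^ (2 / 3 : ℝ) := by positivity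
  -- the two regimes
  rcases le_total (L / a) r₀ with hcase | hcase
  · -- `r = L/a`: `1/r² = a²/L² ≤ √A √(ce) / L²`
    have hrL : r = L / a := min_eq_left hcase
    have hinv : (r ^ 2)⁻¹ ≤ Real.sqrt A * Real.sqrt (c * e) / L ^ 2 := by
      rw [hrL, div_pow, inv_div, div_le_div_iff_of_pos_right (pow_pos hL 2)]
      exact ha2
    have hinv0 : 0 ≤ (r ^ 2)⁻¹ := inv_nonneg.2 hr2.le
    -- `X ≤ min{cA A, ce e/r²} ≤ (cA A)^{2/3} (ce e/r²)^{1/3}`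
    have hmin : X ≤ (cA * A) ^ (2 / 3 : ℝ) * (ce * e / r ^ 2) ^ (1 / 3 : ℝ) :=
      (le_min hXA hXe).trans
        (min_le_rpow_two_thirds_mul_rpow_third (by positivity) (by positivity))
    -- rewrite the right-hand side as `(1/r²)^{1/3} · cA^{2/3} ce^{1/3} A^{2/3} e^{1/3}`
    have hsplit : (cA * A) ^ (2 / 3 : ℝ) * (ce * e / r ^ 2) ^ (1 / 3 : ℝ) =
        cA ^ (2 / 3 : ℝ) * ce ^ (1 / 3 : ℝ) * A ^ (2 / 3 : ℝ) * e ^ (1 / 3 : ℝ) *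
          ((r ^ 2)⁻¹) ^ (1 / 3 : ℝ) := by
      rw [Real.div_rpow (by positivity) hr2.le, Real.mul_rpow hcA hA, Real.mul_rpow hce he,
        Real.inv_rpow hr2.le]
      ring
    -- so `X / r² ≤ K A^{2/3} e^{1/3} (1/r²)^{4/3}`
    have hstep : X / r ^ 2 ≤ cA ^ (2 / 3 : ℝ) * ce ^ (1 / 3 : ℝ) * A ^ (2 / 3 : ℝ) * e ^ (1 / 3 : ℝ) *
        ((r ^ 2)⁻¹) ^ (4 / 3 : ℝ) := by
      rw [div_eq_mul_inv]
      have h1 : X * (r ^ 2)⁻¹ ≤ (cA ^ (2 / 3 : ℝ) * ce ^ (1 / 3 : ℝ) * A ^ (2 / 3 : ℝ) * e ^ (1 / 3 : ℝ) *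
          ((r ^ 2)⁻¹) ^ (1 / 3 : ℝ)) * (r ^ 2)⁻¹ := by
        rw [← hsplit]
        exact mul_le_mul_of_nonneg_right hmin hinv0
      have h2 : ((r ^ 2)⁻¹) ^ (1 / 3 : ℝ) * (r ^ 2)⁻¹ = ((r ^ 2)⁻¹) ^ (4 / 3 : ℝ) := by
        conv_lhs => rw [show (r ^ 2)⁻¹ = ((r ^ 2)⁻¹) ^ (1 : ℝ) from (Real.rpow_one _).symm,
          ← Real.rpow_mul hinv0]
        rw [← Real.rpow_add (inv_pos.2 hr2)]
        norm_num
      calc X * (r ^ 2)⁻¹ ≤ (cA ^ (2 / 3 : ℝ) * ce ^ (1 / 3 : ℝ) * A ^ (2 / 3 : ℝ) * e ^ (1 / 3 : ℝ) *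
            ((r ^ 2)⁻¹) ^ (1 / 3 : ℝ)) * (r ^ 2)⁻¹ := h1
        _ = cA ^ (2 / 3 : ℝ) * ce ^ (1 / 3 : ℝ) * A ^ (2 / 3 : ℝ) * e ^ (1 / 3 : ℝ) *
            ((r ^ 2)⁻¹) ^ (4 / 3 : ℝ) := by rw [mul_assoc, h2]
    -- `(1/r²)^{4/3} ≤ (√A √(ce)/L²)^{4/3} = A^{2/3} c^{2/3} e^{2/3} / L^{8/3}`
    have hpow : ((r ^ 2)⁻¹) ^ (4 / 3 : ℝ) ≤ A ^ (2 / 3 : ℝ) * (c ^ (2 / 3 : ℝ) * e ^ (2 / 3 : ℝ)) /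
        L ^ (8 / 3 : ℝ) := by
      have h1 : ((r ^ 2)⁻¹) ^ (4 / 3 : ℝ) ≤ (Real.sqrt A * Real.sqrt (c * e) / L ^ 2) ^ (4 / 3 : ℝ) :=
        Real.rpow_le_rpow hinv0 hinv (by norm_num)
      have h2 : (Real.sqrt A * Real.sqrt (c * e) / L ^ 2) ^ (4 / 3 : ℝ) =
          A ^ (2 / 3 : ℝ) * (c ^ (2 / 3 : ℝ) * e ^ (2 / 3 : ℝ)) / L ^ (8 / 3 : ℝ) := by
        rw [Real.div_rpow (by positivity) (by positivity), Real.mul_rpow (Real.sqrt_nonneg _)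
          (Real.sqrt_nonneg _), Real.sqrt_eq_rpow, Real.sqrt_eq_rpow, ← Real.rpow_mul hA,
          ← Real.rpow_mul (by positivity), Real.mul_rpow hc he, ← Real.rpow_natCast,
          ← Real.rpow_mul hL.le]
        norm_num
      rw [← h2]
      exact h1
    -- assemble: `A^{2/3} A^{2/3} = A^{4/3}`, `e^{1/3} e^{2/3} = e`
    have hAA : A ^ (2 / 3 : ℝ) * A ^ (2 / 3 : ℝ) = A ^ (4 / 3 : ℝ) := by
      rw [← Real.rpow_add' hA (by norm_num)]; norm_num
    have hee : e ^ (1 / 3 : ℝ) * e ^ (2 / 3 : ℝ) = e := by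
      rw [← Real.rpow_add' he (by norm_num)]; norm_num
    calc X / r ^ 2 ≤ cA ^ (2 / 3 : ℝ) * ce ^ (1 / 3 : ℝ) * A ^ (2 / 3 : ℝ) * e ^ (1 / 3 : ℝ) *
          ((r ^ 2)⁻¹) ^ (4 / 3 : ℝ) := hstep
      _ ≤ cA ^ (2 / 3 : ℝ) * ce ^ (1 / 3 : ℝ) * A ^ (2 / 3 : ℝ) * e ^ (1 / 3 : ℝ) *
          (A ^ (2 / 3 : ℝ) * (c ^ (2 / 3 : ℝ) * e ^ (2 / 3 : ℝ)) / L ^ (8 / 3 : ℝ)) :=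
          mul_le_mul_of_nonneg_left hpow (by positivity)
      _ = cA ^ (2 / 3 : ℝ) * ce ^ (1 / 3 : ℝ) * c ^ (2 / 3 : ℝ) * e *
          (A ^ (4 / 3 : ℝ) / L ^ (8 / 3 : ℝ)) := by
          rw [show cA ^ (2 / 3 : ℝ) * ce ^ (1 / 3 : ℝ) * A ^ (2 / 3 : ℝ) * e ^ (1 / 3 : ℝ) *
              (A ^ (2 / 3 : ℝ) * (c ^ (2 / 3 : ℝ) * e ^ (2 / 3 : ℝ)) / L ^ (8 / 3 : ℝ)) =
              cA ^ (2 / 3 : ℝ) * ce ^ (1 / 3 : ℝ) * c ^ (2 / 3 : ℝ) * (e ^ (1 / 3 : ℝ) * e ^ (2 / 3 : ℝ)) *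
                (A ^ (2 / 3 : ℝ) * A ^ (2 / 3 : ℝ) / L ^ (8 / 3 : ℝ)) by ring, hAA, hee]
      _ ≤ (cA ^ (2 / 3 : ℝ) * ce ^ (1 / 3 : ℝ) * c ^ (2 / 3 : ℝ) + ce) * e *
          max (A ^ (4 / 3 : ℝ) / L ^ (8 / 3 : ℝ)) (r₀ ^ 4)⁻¹ := by
          have h1 : A ^ (4 / 3 : ℝ) / L ^ (8 / 3 : ℝ) ≤ max (A ^ (4 / 3 : ℝ) / L ^ (8 / 3 : ℝ)) (r₀ ^ 4)⁻¹ :=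
            le_max_left _ _
          have h2 : cA ^ (2 / 3 : ℝ) * ce ^ (1 / 3 : ℝ) * c ^ (2 / 3 : ℝ) * e ≤
              (cA ^ (2 / 3 : ℝ) * ce ^ (1 / 3 : ℝ) * c ^ (2 / 3 : ℝ) + ce) * e := by
            nlinarith
          exact mul_le_mul h2 h1 (by positivity) (by positivity)
  · -- `r = r₀`: `X/r₀² ≤ ce e/r₀⁴`
    have hrr : r = r₀ := min_eq_right hcase
    rw [hrr] at hXe ⊢
    have hr₀2 : 0 < r₀ ^ 2 := pow_pos hr₀ 2
    calc X / r₀ ^ 2 ≤ (ce * e / r₀ ^ 2) / r₀ ^ 2 := by gcongr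
      _ = ce * e * (r₀ ^ 4)⁻¹ := by field_simp
      _ ≤ (cA ^ (2 / 3 : ℝ) * ce ^ (1 / 3 : ℝ) * c ^ (2 / 3 : ℝ) + ce) * e *
          max (A ^ (4 / 3 : ℝ) / L ^ (8 / 3 : ℝ)) (r₀ ^ 4)⁻¹ := by
          have h1 : (r₀ ^ 4)⁻¹ ≤ max (A ^ (4 / 3 : ℝ) / L ^ (8 / 3 : ℝ)) (r₀ ^ 4)⁻¹ := le_max_right _ _
          have h2 : ce * e ≤ (cA ^ (2 / 3 : ℝ) * ce ^ (1 / 3 : ℝ) * c ^ (2 / 3 : ℝ) + ce) * e := by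
            nlinarith
          exact mul_le_mul h2 h1 (by positivity) (by positivity)

end Wei2016

end Literature.Analysis.FluidPDE

end
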